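import Summits.QuantumFields.YangMills.Theorems.BalabanUVNodesN22W1RelCentredMembersOfDatum
import Literature.MathematicalPhysics.QuantumFieldTheory.Balaban1983to89.B13Term214ParamHolo
import Literature.MathematicalPhysics.QuantumFieldTheory.Balaban1983to89.B13Lemma3TorusPrimitivePoly

/-!
# BalabanUVNodes ∕ node N22 = NE9 — THE W1 OBJECT ON THE RELATIVE-DISC CENTRED ROAD (RE-TYPING M1′), MODULE J8: (P) FOR THE COUPLING-BLIND CENTRE OF THE DATUM, KERNEL-KEYED —
# holomorphy and the (2.26) bound of `z ↦ V(cv z)` along an older-term curve, for the box-free background-valued member `V(old) = term(A, Γ, F214 |P| 1 1 𝐃 (Y ↦ 𝒪(old,φ,Y,0)))`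
# (J7a §2's centre), from located inputs by the UNdilated engines (module 36's parametric holomorphy + W1-8's `h226_torus_of_primitives_holo_polyτ`)

Cell `pub-ymgap`, HUMAN RULING D-0062 (Track A), R134 ACCELERATION re-seat `pub-ymgap-dag-n22-c` (strategy s1), generation 7, file J8.  THEOREMS ONLY; imports J5 `…N22W1RelCentredMembersOfDatum`
(W1-7's datum), `B13Term214ParamHolo` and `B13Lemma3TorusPrimitivePoly` BY NAME.  `--supports` the K3 item of record as a helper.

WHY.  J2 ∕ J3 ∕ J4 display the (P)-schema `hpropV` for the coupling-blind centre `V`: along every bounded holomorphic older-term curve `cv` on an open `O`, `z ↦ V k′ Z t (cv z) φ` holomorphic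
on `O` with the (2.26) weight bound.  For the member family of the datum the centre is (J7a §2 ∕ §4) `V := if P(t) = ∅ then term(A,Γ,F214 |P| 1 1 𝐃 (Y ↦ 𝒪(old,φ,Y,0))) else 0` — the
box-free member with FIELD-CONSTANT potentials (the older terms at zero unscaled fluctuation field), built from the datum's coupling-blind kernels: no base point, no dilation parameter.
Its (P)-schema is therefore the UNdilated parametric holomorphy of module 36 (the parameter enters the potentials only — [II] (1.41): the history enters through 𝐕_k) plus W1-8's (2.26)
engine at `χ := 1`, pointwise along the curve; without large-field boxes (2.22) is free.  THIS FILE is that reading (one theorem); the `P(t) ≠ ∅` branch (`V = 0`) is trivial.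

WHAT.  ★ `differentiableOn_and_norm_centreOfDatum_of_primitives` (`P(t) = ∅`) · `propV_byCases` (the `if` of J7a §4: the `else 0` branch from `weight_nonneg`).

HONEST FRAMING.  Count-neutral kernel-keyed reading of two landed theorems (no estimate proved here); located inputs are HYPOTHESES (NODE A's kernel letters, the older terms' value at zero
field along the curve: `Σ|τ||𝒪(cv z,φ,Y,0)| ≤ w₀`, holomorphy in `z` — a producer's law of Lemma 2's potentials, displayed; numerics); nothing of Bałaban's asserted; N22 NOT discharged; one
finite four-torus programme at fixed ε — NOT infinite volume, NOT OS on ℝ⁴, NOT a mass gap, NOT Clay.  0 `sorry`, 0 `def`, standard axioms.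

References (TYPES only): [II] = [Balaban1988RG2Cluster] (1.41) p. 11, (2.14)–(2.26) pp. 15–17; [I] = [Balaban1987RG1] (2.12)–(2.13) p. 268.
-/

noncomputable section

namespace YMDAG.N22.W1

open Set Metric Matrix
open scoped BigOperators
open Literature.MathematicalPhysics.QuantumFieldTheory.Balaban1983to89
open Literature.MathematicalPhysics.QuantumFieldTheory.Balaban1983to89.B13Term214 (term214 core214 F214)
open Literature.MathematicalPhysics.QuantumFieldTheory.Balaban1983to89.B13Term214ParamHolo (differentiableOn_term214_torus_of_primitives_holo_polyτ)
open Literature.MathematicalPhysics.QuantumFieldTheory.Balaban1983to89.B13Lemma3TorusPrimitivePoly (h226_torus_of_primitives_holo_polyτ)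
open Literature.MathematicalPhysics.QuantumFieldTheory.Balaban1983to89.TreeLengthTorus (TPt TDom tsys)
open Literature.MathematicalPhysics.QuantumFieldTheory.Balaban1983to89.B13Lemma3TorusTerms (weight weight_nonneg)
open Literature.MathematicalPhysics.QuantumFieldTheory.Balaban1983to89.B13Bound143 (invTau)
open Literature.MathematicalPhysics.QuantumFieldTheory.Balaban1983to89.B9Thm37GlueTorus (tdist1)
open Literature.MathematicalPhysics.QuantumFieldTheory.Balaban1983to89.B5TorusCover (UT)
open Literature.MathematicalPhysics.QuantumFieldTheory.Balaban1983to89.Node00.Sect2 (domSys domCount CPair)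
open Literature.MathematicalPhysics.QuantumFieldTheory.Balaban1983to89.Node00.W1

variable {c₀ : B13.Consts} {P : Params} {𝔸 : Type*} {M k L : ℕ} [NeZero L] (𝔇 : TermDatum214 c₀ P 𝔸 M k L)
  (𝒪 : (Z : (domSys P M (k + 1)).Dom) → (t : TermLabel P M k L) → OlderTerms P 𝔸 M k → CPair P 𝔸 → TDom P.d (L * domCount P M (k + 1)) →
    ((𝔇.𝒦 Z t).Λ → ℝ) → ℂ)

/-! ## §1 (P) for the box-free centre of a term WITHOUT large-field boxes: holomorphy and the (2.26) bound along an older-term curve, UNdilated engines -/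

open Classical in
/-- **(P) FOR THE COUPLING-BLIND CENTRE OF THE DATUM ALONG AN OLDER-TERM CURVE, KERNEL-KEYED (`P(t) = ∅`)** — the centre of J7a §2,
`V(old) := term(A, Γ, F214 |P| 1 1 𝐃 (Y ↦ 𝒪(old, φ, Y, 0)))` (no boxes, potentials frozen to the older terms' value at zero unscaled fluctuation field; no base point, no dilation parameter),
along a curve `cv : ℂ → OlderTerms` on an open `O`: `z ↦ V(cv z)` is holomorphic on `O` (`B13Term214ParamHolo.differentiableOn_term214_torus_of_primitives_holo_polyτ`, parameter in the
potentials only) with `‖V(cv z)‖ ≤ weight L M c Z a t · e^{a₅|Z|}` there (`B13Lemma3TorusPrimitivePoly.h226_torus_of_primitives_holo_polyτ`, W1-8's engine, at each `z`) — the consequent of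
J2's `hpropV` at this slice for `P(t) = ∅`.  Located inputs: W1-8's list at `χ := 1` (NODE A's kernel letters incl. `Re A ≻ 0` on the σ-polydisc, regions, Cauchy radius, numerics with
`a₂₀ := 0`) + `Σ|τ||𝒪(cv z, φ, Y, 0)| ≤ w₀` on the τ-region uniformly in `z` and `z ↦ 𝒪(cv z, φ, Y, 0)` holomorphic on `O`; `|P(t)| = 0` makes (2.22) free at `χ = 1` (any `γ₂ ≥ 0`,
`r_P`).  One application of each tree theorem; no estimate proved here.
[cite: Balaban1988RG2Cluster, (1.41) p.11, (2.14)-(2.15) p.15, (2.16)-(2.22) p.16, (2.23)-(2.26) p.17; Balaban1987RG1, (2.12)-(2.13) p.268] -/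
theorem differentiableOn_and_norm_centreOfDatum_of_primitives
    (Z : (domSys P M (k + 1)).Dom) (t : TermLabel P M k L) (φ : CPair P 𝔸) (hP0 : t.2.card = 0)
    {O : Set ℂ} (hO : IsOpen O) (cv : ℂ → OlderTerms P 𝔸 M k)
    (hOd0 : ∀ Y, DifferentiableOn ℂ (fun z => 𝒪 Z t (cv z) φ Y 0) O)
    (c : B13.Consts)
    (hκ₁ : 1 ≤ c.κ₁)
    (hα₆ : c.α₆ ≠ 0)
    (hpos : ∀ Y : TDom P.d (L * domCount P M (k + 1)), 0 < invTau c ((tsys P.d (L * domCount P M (k + 1))).dj Y))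
    (hhalf : ∀ Y : TDom P.d (L * domCount P M (k + 1)), invTau c ((tsys P.d (L * domCount P M (k + 1))).dj Y) ≤ 1 / 2)
    {Uσ : Set ℂ}
    {Uτ : TDom P.d (L * domCount P M (k + 1)) → Set ℂ}
    (hUσ : IsOpen Uσ)
    (hUτ : ∀ Y, IsOpen (Uτ Y))
    (hUexp : closedBall (0 : ℂ) (Real.exp c.κ₁) ⊆ Uσ)
    (hUtau : ∀ Y : TDom P.d (L * domCount P M (k + 1)), closedBall (0 : ℂ) ((invTau c ((tsys P.d (L * domCount P M (k + 1))).dj Y))⁻¹) ⊆ Uτ Y)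
    (hr : 0 < 𝔇.r)
    (hr' : 𝔇.r ≤ Real.exp c.κ₁ - 1)
    (hsubτ : ∀ Y, ∀ s ∈ Set.uIcc (0 : ℝ) 1, closedBall (s : ℂ) 𝔇.r ⊆ Uτ Y)
    -- the parameter lists of the term: σ over the blocks of Z∖Z′₀, τ over 𝐃
    -- the (2.14)-data of the term
    -- replaces hΨσ ∕ hΨτ: entrywise holomorphy of A(σ), G(σ) on the OPEN σ-polydisc, measurability of the last line's
    -- ingredients; the σ-letters below on the open σ-polydisc {σ | ∀ j, σ j ∈ Uσ} (⊇ the closed e^{κ₁}-ball)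
    (hAhol : ∀ i j, DifferentiableOn ℂ (fun σ => 𝔇.A Z t φ σ i j) {σ | ∀ j, σ j ∈ Uσ})
    (hAs : ∀ σ : TPt P.d (domCount P M (k + 1)) → ℂ, (∀ j, σ j ∈ Uσ) → (𝔇.A Z t φ σ).IsSymm)
    (hA : ∀ σ : TPt P.d (domCount P M (k + 1)) → ℂ, (∀ j, σ j ∈ Uσ) → ((𝔇.A Z t φ σ).map Complex.re).PosDef)
    -- the Γ-operator is linear with kernel G(σ), entrywise holomorphic
    (hGhol : ∀ i j, DifferentiableOn ℂ (fun σ => (𝔇.𝒦 Z t).G2 σ (𝔇.uOf Z t φ) i j) {σ | ∀ j, σ j ∈ Uσ})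
    -- the (2.22) shape, and (2.20) on the open PER-DOMAIN τ-region (print's per-domain radii (2.18), torus-uniform)
    {γ₂ rP a₂₀ w : ℝ}
    (hγ₂ : 0 ≤ γ₂)
    (ha0 : 0 ≤ a₂₀)
    -- bonds located on the torus `UT Nf`
    (hfibN : ∀ x : UT 𝔇.Nf, (Finset.univ.filter fun j => (𝔇.𝒦 Z t).locN j = x).card ≤ (𝔇.𝒦 Z t).m)
    -- rates and constants
    {kap kap' kap'' θ θE θΓ θC KG KΓ KCs K₀ : ℝ}
    (hkap'' : 0 < kap'')
    (h1 : kap'' < kap')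
    (h2 : kap' < kap)
    (hθE : 0 ≤ θE)
    (hθΓ : 0 ≤ θΓ)
    (hθC : 0 ≤ θC)
    (hKG : 0 ≤ KG)
    (hKΓ : 0 ≤ KΓ)
    (hKCs : 0 ≤ KCs)
    (hK₀ : 0 ≤ K₀)
    (hθEle : θE ≤ θ)
    (hθΓle : θΓ ≤ θ)
    (hθR1le : ((𝔇.𝒦 Z t).m * (1 + 2 / (kap - kap')) ^ 𝔇.ν) * ((𝔇.𝒦 Z t).m * (1 + 2 / (kap' - kap'')) ^ 𝔇.ν)
      * (θΓ * KCs * KG + KΓ * θC * KG + KΓ * K₀ * θΓ) ≤ θ)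
    -- uniform localisation of the primitive kernels in the torus distance (L17a)
    (hG : ∀ σ : TPt P.d (domCount P M (k + 1)) → ℂ, (∀ j, σ j ∈ Uσ) →
      ∀ b j, ‖(𝔇.𝒦 Z t).G2 σ (𝔇.uOf Z t φ) b j‖ ≤ KG * Real.exp (-(kap * tdist1 𝔇.Nf ((𝔇.𝒦 Z t).locΛ b) ((𝔇.𝒦 Z t).locN j))))
    (hΓ₀ : ∀ b j, ‖(𝔇.𝒦 Z t).Γ₀ b j‖ ≤ KΓ * Real.exp (-(kap * tdist1 𝔇.Nf ((𝔇.𝒦 Z t).locΛ b) ((𝔇.𝒦 Z t).locN j))))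
    (hCs : ∀ σ : TPt P.d (domCount P M (k + 1)) → ℂ, (∀ j, σ j ∈ Uσ) →
      ∀ b b', ‖(𝔇.A Z t φ σ)⁻¹ b b'‖ ≤ KCs * Real.exp (-(kap * tdist1 𝔇.Nf ((𝔇.𝒦 Z t).locΛ b) ((𝔇.𝒦 Z t).locΛ b'))))
    (hC216 : ∀ b b', ‖(𝔇.𝒦 Z t).C b b'‖ ≤ K₀ * Real.exp (-(kap * tdist1 𝔇.Nf ((𝔇.𝒦 Z t).locΛ b) ((𝔇.𝒦 Z t).locΛ b'))))
    -- the (2.16)-type differences of the primitive kernels in the torus distance (L16a)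
    (hdΓ : ∀ σ : TPt P.d (domCount P M (k + 1)) → ℂ, (∀ j, σ j ∈ Uσ) →
      ∀ b j, ‖((𝔇.𝒦 Z t).G2 σ (𝔇.uOf Z t φ) - (𝔇.𝒦 Z t).Γ₀.map (algebraMap ℝ ℂ)) b j‖ ≤ θΓ * Real.exp (-(kap * tdist1 𝔇.Nf ((𝔇.𝒦 Z t).locΛ b) ((𝔇.𝒦 Z t).locN j))))
    (hdC : ∀ σ : TPt P.d (domCount P M (k + 1)) → ℂ, (∀ j, σ j ∈ Uσ) →
      ∀ b b', ‖((𝔇.A Z t φ σ)⁻¹ - (𝔇.𝒦 Z t).C.map (algebraMap ℝ ℂ)) b b'‖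
        ≤ θC * Real.exp (-(kap * tdist1 𝔇.Nf ((𝔇.𝒦 Z t).locΛ b) ((𝔇.𝒦 Z t).locΛ b'))))
    (hdE : ∀ σ : TPt P.d (domCount P M (k + 1)) → ℂ, (∀ j, σ j ∈ Uσ) →
      ∀ b b', ‖(𝔇.A Z t φ σ - (𝔇.𝒦 Z t).C⁻¹.map (algebraMap ℝ ℂ)) b b'‖ ≤ θE * Real.exp (-(kap * tdist1 𝔇.Nf ((𝔇.𝒦 Z t).locΛ b) ((𝔇.𝒦 Z t).locΛ b'))))
    (hsmallKθ : K₀ * ((𝔇.𝒦 Z t).m * (1 + 2 / kap) ^ 𝔇.ν) * (θ * ((𝔇.𝒦 Z t).m * (1 + 2 / kap'') ^ 𝔇.ν)) < 1)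
    -- the (2.24)–(2.25) smallness
    {cE g : ℝ}
    (hc0 : 0 ≤ cE)
    (hc : ∀ k, (𝔇.𝒦 Z t).hC.1.eigenvalues k ≤ cE)
    (hαc : (2 * (θ * ((𝔇.𝒦 Z t).m * (1 + 2 / kap'') ^ 𝔇.ν)) + (γ₂ + a₂₀)) * cE ≤ 1 / 2)
    (hg : 0 ≤ g)
    (hΓq : ∀ X : (𝔇.𝒦 Z t).Λ ⊕ (𝔇.𝒦 Z t).C₀ → ℝ, ((𝔇.𝒦 Z t).Γ₀ *ᵥ X) ⬝ᵥ ((𝔇.𝒦 Z t).C *ᵥ ((𝔇.𝒦 Z t).Γ₀ *ᵥ X)) ≤ g * (X ⬝ᵥ X))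
    (hsmall : (2 * (θ * ((𝔇.𝒦 Z t).m * (1 + 2 / kap'') ^ 𝔇.ν)) + (γ₂ + a₂₀)) * (1 + 2 * cE * g) ≤ 1 / 2)
    -- constant matching, p. 17: the |P|-rate of the weight and «exp O(1)α₅|Z|»
    {a a₅ : ℝ}
    (hPa : a ≤ γ₂ * rP ^ 2)
    (hvol : 2 * (K₀ * ((𝔇.𝒦 Z t).m * (1 + 2 / kap) ^ 𝔇.ν) * (θ * ((𝔇.𝒦 Z t).m * (1 + 2 / kap'') ^ 𝔇.ν))
              * (1 + (1 - K₀ * ((𝔇.𝒦 Z t).m * (1 + 2 / kap) ^ 𝔇.ν) * (θ * ((𝔇.𝒦 Z t).m * (1 + 2 / kap'') ^ 𝔇.ν)))⁻¹) / 2)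
          * (Fintype.card (𝔇.𝒦 Z t).Λ : ℝ)
        + w + (2 * (θ * ((𝔇.𝒦 Z t).m * (1 + 2 / kap'') ^ 𝔇.ν)) + (γ₂ + a₂₀)) * cE * (Fintype.card (𝔇.𝒦 Z t).Λ : ℝ)
        + (2 * (θ * ((𝔇.𝒦 Z t).m * (1 + 2 / kap'') ^ 𝔇.ν)) + (γ₂ + a₂₀)) * (1 + 2 * cE * g) * (Fintype.card ((𝔇.𝒦 Z t).Λ ⊕ (𝔇.𝒦 Z t).C₀) : ℝ)
        ≤ a₅ * ((Z.1).card : ℝ))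
    -- the older terms' value at zero field ALONG THE CURVE: the (2.20)-type bound on the τ-region, uniform in `z` (Lemma 2 at the background)
    (h220V : ∀ z ∈ O, ∀ τ : TDom P.d (L * domCount P M (k + 1)) → ℂ, (∀ Y, τ Y ∈ Uτ Y) →
      ∀ B : (𝔇.𝒦 Z t).Λ → ℝ, ∑ Y ∈ t.1, ‖τ Y‖ * ‖𝒪 Z t (cv z) φ Y 0‖ ≤ a₂₀ / 2 * (B ⬝ᵥ B) + w) :
    DifferentiableOn ℂ (fun z : ℂ => term214 𝔇.r (sigmaList L Z t) (tauList P M k L t)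
        (core214 (𝔇.A Z t φ) (𝔇.Gam Z t φ) (F214 t.2.card (fun _ => (1 : ℝ)) (fun _ => (1 : ℝ)) t.1 (fun Y _ => 𝒪 Z t (cv z) φ Y 0))) 0 0) O ∧
    ∀ z ∈ O, ‖term214 𝔇.r (sigmaList L Z t) (tauList P M k L t)
        (core214 (𝔇.A Z t φ) (𝔇.Gam Z t φ) (F214 t.2.card (fun _ => (1 : ℝ)) (fun _ => (1 : ℝ)) t.1 (fun Y _ => 𝒪 Z t (cv z) φ Y 0))) 0 0‖ ≤
      weight L M c Z a t * Real.exp (a₅ * ((Z.1).card : ℝ)) := by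
  -- (2.22) is free without large-field boxes at `χ = χᶜ = 1`
  have h222V : ∀ B : (𝔇.𝒦 Z t).Λ → ℝ, (fun _ => (1 : ℝ)) B * (fun _ => (1 : ℝ)) B ≤ Real.exp (-(γ₂ / 2 * rP ^ 2 * (t.2.card : ℕ)) + γ₂ / 2 * (fun B => B ⬝ᵥ B) B) :=
    fun B => by
      have hB : 0 ≤ B ⬝ᵥ B := Finset.sum_nonneg fun i _ => mul_self_nonneg (B i)
      rw [hP0]
      simp only [Nat.cast_zero, mul_zero, neg_zero, zero_add, one_mul]
      exact Real.one_le_exp (mul_nonneg (by positivity) hB)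
  refine ⟨?_, fun z hz => ?_⟩
  · exact differentiableOn_term214_torus_of_primitives_holo_polyτ c hO hUσ hUτ hUexp hr hr' hsubτ (lZ := (sigmaList L Z t)) (sigmaList_spec Z t).1 (lD := (tauList P M k L t)) (tauList_spec t).1 (𝔇.A Z t φ) (𝔇.Gam Z t φ) t.2.card (fun _ => (1 : ℝ)) (fun _ => (1 : ℝ)) (fun _ => zero_le_one) (fun _ => zero_le_one) t.1 (fun z Y _ => 𝒪 Z t (cv z) φ Y 0) (𝔇.𝒦 Z t).hC (𝔇.𝒦 Z t).Γ₀ hAhol measurable_const measurable_const (fun z _ Y => measurable_const) (fun Y _ => hOd0 Y) hAs hA (fun σ => (𝔇.𝒦 Z t).G2 σ (𝔇.uOf Z t φ)) hGhol (fun _ _ _ => rfl) (fun B => B ⬝ᵥ B) h222V hγ₂ (fun _ => le_rfl) ha0 h220V (𝔇.𝒦 Z t).locΛ (𝔇.𝒦 Z t).locN (𝔇.𝒦 Z t).hfib hfibN hkap'' h1 h2 hθE hθΓ hθC hKG hKΓ hKCs hK₀ hθEle hθΓle hθR1le hG hΓ₀ hCs hC216 hdΓ hdC hdE hsmallKθ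 hc0 hc hαc hΓq hsmall
  · exact h226_torus_of_primitives_holo_polyτ c hκ₁ hα₆ Z t hpos hhalf hUσ hUτ hUexp hUtau hr hr' hsubτ (sigmaList L Z t) (sigmaList_spec Z t) (tauList P M k L t) (tauList_spec t) (𝔇.A Z t φ) (𝔇.Gam Z t φ) (fun _ => (1 : ℝ)) (fun _ => (1 : ℝ)) (fun _ => zero_le_one) (fun _ => zero_le_one) t.1 (fun Y _ => 𝒪 Z t (cv z) φ Y 0) (𝔇.𝒦 Z t).hC (𝔇.𝒦 Z t).Γ₀ hAhol measurable_const measurable_const (fun Y => measurable_const) hAs hA (fun σ => (𝔇.𝒦 Z t).G2 σ (𝔇.uOf Z t φ)) hGhol (fun _ _ _ => rfl) (fun B => B ⬝ᵥ B) h222V hγ₂ (fun _ => le_rfl) ha0 (h220V z hz) (𝔇.𝒦 Z t).locΛ (𝔇.𝒦 Z t).locN (𝔇.𝒦 Z t).hfib hfibN hkap'' h1 h2 hθE hθΓ hθC hKG hKΓ hKCs hK₀ hθEle hθΓle hθR1le hG hΓ₀ hCs hC216 hdΓ hdC hdE hsmallKθ hc0 hc hαc hg hΓq hsmall hPa hv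ol

/-- **THE `P(t) ≠ ∅` BRANCH IS TRIVIAL** — the centre of J7a §4 is `if P(t) = ∅ then V(old) else 0`; along any curve the (P)-schema of the `if` follows from §1's for the box-free centre
(the `else 0` branch: a constant is holomorphic and `0 ≤` the weight). [cite: Balaban1988RG2Cluster, (2.26) p.17] (elementary) -/
theorem propV_byCases {P0 : Prop} [Decidable P0] {O : Set ℂ} {Vc : ℂ → ℂ} {W : ℝ} (hW : 0 ≤ W)
    (h : P0 → DifferentiableOn ℂ Vc O ∧ ∀ z ∈ O, ‖Vc z‖ ≤ W) :
    DifferentiableOn ℂ (fun z => if P0 then Vc z else 0) O ∧ ∀ z ∈ O, ‖(if P0 then Vc z else 0)‖ ≤ W := by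
  by_cases hP : P0
  · simp only [hP, if_true]; exact h hP
  · simp only [hP, if_false]; exact ⟨differentiableOn_const 0, fun z _ => by rw [norm_zero]; exact hW⟩

end YMDAG.N22.W1

end
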